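import Literature.AnabelianGeometry.SemiGraphs.CoveringGraphPullbackSquareCartesian
import HarnessLib

/-!
# [SemiAnbd] Prop 4.4 (i), first reduction: a covering with SMALL STABILISERS on the image of `ψ` pulls back to a LOCALLY
# TRIVIAL arrow `𝒢'_{ψ^*S} → 𝒢_S` (the «reduce to `H → K` locally trivial» step, as an implication; proof-only)

Mochizuki, *Semi-graphs of anabelioids*, Publ. RIMS **42** (2006), §4, proof of Prop 4.4 (i) p. 55: «Since `K` is quasi-coherent,
it follows from Proposition 2.5, (i), that we may reduce immediately to the case where the given morphism `H → K` is locally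
trivial»; Def 2.2 (ii) p. 24 (locally trivial); Rmk 2.2.1 p. 24 («the image of each `Π_v` (respectively, `Π_b`) in `Π_𝒢` is
equal to the stabilizer of a compatible system of vertices (respectively, edges) of this pro-semi-graph» — applied in the tree
to the constituents `Π_{v′}` of the covering) (kurims `paper:url-f33ace170ff4`). [cite: MochizukiSemiAnbd2006, Prop 4.4 (i), p. 54]

PROOF-ONLY (cell abc-iut, layer L3, seat abc-iut-f-161 gen 8, row «PROP46⟸PULLBACK+P44i» stage 2c FILE E = item (2c-⇒) of
HOME/staging/f/f-161/g8/SHAPES-2c.md; no definition).  Over stage 1a's fibre square (`Hom.covPullbackSnd`): the MECHANISM of print's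
reduction.  If a covering object `S ∈ B^cov(K)` has SMALL STABILISERS ON THE IMAGE of `ψ : H → K` — at every vertex-orbit `(w, o)`
of `𝒢'_{ψ^*S}` the stabiliser in `Π_{K,ψ w}` of the base point `pt o ∈ S_{ψ w}` lies inside `ψ_w(Π_{H,w})` (likewise for edges) —
then the second projection `𝒢'_{ψ^*S} → 𝒢_S` has BIJECTIVE constituents wherever `ψ` has injective ones:
`covPullbackSnd_hV_bijective_of_stab_le` / `_hE_…`, **`covPullbackSnd_isLocallyTrivial_of_stab_le`** (FILE B's
`covPullbackSnd_isLocallyTrivial` is the case `ψ` locally trivial).  The EXISTENCE of such a finite `S` for quasi-coherent `K`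
— Prop 2.5 (i) — is NOT proved here (item (2c-∃), BObj-side engine abc-iut-L3-d1's `exists_pullback_splits_restrict`); nothing
printed is asserted; no side taken on [IUTchIII] Cor. 3.12.
-/

noncomputable section

namespace Literature.AnabelianGeometry.SemiGraphs

open CategoryTheory
open Literature.AlgebraicGeometry.Frobenioids.QuasiTemperoid.BTempConnected (hom_ρ ρ_one_apply
  ρ_mul_apply ρ_inv_apply)

universe u

namespace ProfiniteSemiGraph

namespace Hom

variable {H₁ K : ProfiniteSemiGraph.{u}} (ψ : Hom H₁ K) (θ : ψ.ConjugatorFamily) (S : CovObj K)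

/-- **Bijective vertex constituent from a SMALL STABILISER**: if `ψ_w` is injective and the stabiliser in `Π_{K,ψ w}` of the base
point `pt o ∈ S_{ψ w} = (ψ^*S)_w` lies inside `ψ_w(Π_{H,w})`, then the constituent of `𝒢'_{ψ^*S} → 𝒢_S` at `(w, o)` is bijective
(onto: a stabiliser element of the chosen base point conjugates back into `Stab(pt o) ⊆ range ψ_w`, and its preimage stabilises
for the action THROUGH `ψ_w`). [cite: MochizukiSemiAnbd2006, Rem. 2.2.1 p.24] -/
theorem covPullbackSnd_hV_bijective_of_stab_le (ν : ((ψ.covPullbackWith θ).obj S).coveringSemiGraph.Vertex)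
    (hinj : Function.Injective (ψ.hV ν.1))
    (hstab : ∀ k : K.Gv ((((ψ.covPullbackWith θ).obj S).coveringHom.comp ψ).base.vertexMap ν),
      (S.SV _).obj.ρ k (ψ.covPullbackPtV θ S ν) = ψ.covPullbackPtV θ S ν → ∃ m : H₁.Gv ν.1, ψ.hV ν.1 m = k) :
    Function.Bijective ((ψ.covPullbackSnd θ S).hV ν) := by
  refine ⟨ψ.covPullbackSnd_hV_injective θ S ν hinj, ?_⟩
  rw [covPullbackSnd_hV]
  refine conjInto_surjective _ _ _ _ fun k hk => ?_
  have hk' := CovObj.conj_inv_mem_stab _ _ _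
    (CovObj.gV_spec (((ψ.covPullbackWith θ).obj S).coveringHom.comp ψ) S (ψ.covPullbackPtV θ S) ν) hk
  obtain ⟨m, hm⟩ := hstab _ hk'
  have hmstab : m ∈ BTemp.stab (((ψ.covPullbackWith θ).obj S).SV ν.1) (Quot.out ν.2) := by
    change (S.SV (ψ.base.vertexMap ν.1)).obj.ρ (ψ.hV ν.1 m) (Quot.out ν.2) = Quot.out ν.2
    rw [hm]
    exact hk'
  exact ⟨⟨m, hmstab⟩, hm⟩

/-- The edge analogue. [cite: MochizukiSemiAnbd2006, Rem. 2.2.1 p.24] -/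
theorem covPullbackSnd_hE_bijective_of_stab_le (ε : ((ψ.covPullbackWith θ).obj S).coveringSemiGraph.Edge)
    (hinj : Function.Injective (ψ.hE ε.1))
    (hstab : ∀ k : K.Ge ((((ψ.covPullbackWith θ).obj S).coveringHom.comp ψ).base.edgeMap ε),
      (S.SE _).obj.ρ k (ψ.covPullbackPtE θ S ε) = ψ.covPullbackPtE θ S ε → ∃ m : H₁.Ge ε.1, ψ.hE ε.1 m = k) :
    Function.Bijective ((ψ.covPullbackSnd θ S).hE ε) := by
  refine ⟨ψ.covPullbackSnd_hE_injective θ S ε hinj, ?_⟩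
  rw [covPullbackSnd_hE]
  refine conjInto_surjective _ _ _ _ fun k hk => ?_
  have hk' := CovObj.conj_inv_mem_stab _ _ _
    (CovObj.gE_spec (((ψ.covPullbackWith θ).obj S).coveringHom.comp ψ) S (ψ.covPullbackPtE θ S) ε) hk
  obtain ⟨m, hm⟩ := hstab _ hk'
  have hmstab : m ∈ BTemp.stab (((ψ.covPullbackWith θ).obj S).SE ε.1) (Quot.out ε.2) := by
    change (S.SE (ψ.base.edgeMap ε.1)).obj.ρ (ψ.hE ε.1 m) (Quot.out ε.2) = Quot.out ε.2
    rw [hm]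
    exact hk'
  exact ⟨⟨m, hmstab⟩, hm⟩

/-- **Print's reduction as an implication**: if `ψ` has injective constituents and `S` has SMALL STABILISERS ON THE IMAGE of `ψ`
(every point of `S` over a vertex `ψ w` / an edge `ψ e′` has its `Π_K`-stabiliser inside the image of the corresponding constituent
of `ψ`), then the second projection `𝒢'_{ψ^*S} → 𝒢_S` of the fibre square is LOCALLY TRIVIAL — «the case where `H → K` is locally
trivial» after base change.  The existence of such a finite `S` for quasi-coherent `K` is Prop 2.5 (i) (not proved here).
[cite: MochizukiSemiAnbd2006, Prop 4.4 (i), p. 54] -/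
theorem covPullbackSnd_isLocallyTrivial_of_stab_le (hinjV : ∀ w, Function.Injective (ψ.hV w))
    (hinjE : ∀ e', Function.Injective (ψ.hE e'))
    (hV : ∀ (w : H₁.graph.Vertex) (t : (S.SV (ψ.base.vertexMap w)).obj.V) (k : K.Gv (ψ.base.vertexMap w)),
      (S.SV _).obj.ρ k t = t → ∃ m : H₁.Gv w, ψ.hV w m = k)
    (hE : ∀ (e' : H₁.graph.Edge) (t : (S.SE (ψ.base.edgeMap e')).obj.V) (k : K.Ge (ψ.base.edgeMap e')),
      (S.SE _).obj.ρ k t = t → ∃ m : H₁.Ge e', ψ.hE e' m = k) :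
    (ψ.covPullbackSnd θ S).IsLocallyTrivial :=
  ⟨fun ν => ψ.covPullbackSnd_hV_bijective_of_stab_le θ S ν (hinjV ν.1) fun k hk => hV ν.1 _ k hk,
    fun ε => ψ.covPullbackSnd_hE_bijective_of_stab_le θ S ε (hinjE ε.1) fun k hk => hE ε.1 _ k hk⟩

end Hom

end ProfiniteSemiGraph

end Literature.AnabelianGeometry.SemiGraphs

end
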